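import Literature.Barriers.CriticalPhenomena.PlaquetteWalkHoleRootPrefixLoopChains
import Literature.Barriers.CriticalPhenomena.PlaquetteWalkHoleRootRootNotchEast
import HarnessLib

/-!
# Barrier catalogue (SAWScalingLimit): THE CUT LAW — along ANY lattice cut from the lower corner of the root edge to the
outside of the domain, a wound under-walk needs TWO live edges: the prefix crosses one, the excursion a LATER one

Leaf of `PlaquetteWalkHoleRootPrefixLoopChains` (the general prefix-loop separation lemma in corner form,
`ΩG.false_of_cornerChain_exit`) and `PlaquetteWalkHoleRootRootNotchEast` (one-route tools, the box vocabulary). Setting: root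
plaquette `w` rooted at `W`, hole `holeFaceW w = (w.1 − 1, w.2) ∉ D`, far cell `farW w`; `ω` a class-`B2a` walk at the far cell;
`J` its excursion polygon (`ΩG.pJ`), `AJ` its winding angle (`ΩG.AJ`; `= 2π·wind` off `J`). A LATTICE CUT is a path of unit
steps between lattice corners `q 0 = (w.1, w.2)` (the lower corner of the root edge), `q 1, …, q K`; its `k`-th edge is the
closed side `(c k).side (s k)` walked by the `k`-th step (`segment_cornerPt_east/north/west/south` of the parent).

§1 THE EXCURSION SIDE (no under/over hypothesis). ★ `ΩG.exit_faces_mem` — every exit mid-edge of a slot of `J` is LIVE (both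
faces in `D`; the last one is the far cell's return side, shared with the face of the last arc). ★ `ΩG.AJ_cornerPt_eq_of_step`
/ ★★ `ΩG.AJ_cornerChain` — TRANSPORT: `AJ` is the same at two corners joined by unit steps none of whose edges is an exit
mid-edge of a slot (a closed lattice side meets `J` only at the midpoint of an exit mid-edge equal to it; lattice corners are
off `J`). ★★ `ΩG.AJ_cornerPt_root_eq_AJ_root` — at the lower corner of the root edge `AJ` equals its value at the root's
midpoint (the lower half of the root edge is off `J`: no slot exits through the root). ★★ EXIT CERTIFICATES
`ΩG.AJ_cornerPt_eq_zero_of_east/west/south/north` — `AJ = 0` at every lattice corner `q` with the whole domain strictly west of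
the column line `x = q.1` (resp. east of it, above the row line `y = q.2`, below it): `J` is drawn inside the faces of `D` up to
one mesh unit across live doors (`ΩG.re_lt_of_mem_pJ_edge` & co.), so that lattice line misses `J` and runs to infinity.
★★★ `ΩG.exists_exit_on_cornerChain_of_AJ_ne_zero` — EXISTENCE: if `J` winds around the root (`AJ ≠ 0` at the root midpoint)
then every lattice cut from the lower corner of the root edge to a corner where `AJ = 0` has an edge that is the exit mid-edge
of a slot (the even–odd rule in its weakest form: at least one crossing).
§2 ★★★★★ `ΩG.exists_prefix_lt_exit_on_cut` — **THE CUT LAW** (under-walks, first side `S`, hole absent): along any lattice cut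
from the lower corner of the root edge to a corner with `AJ = 0`, whose edges are neither the hole's `W` side nor the root edge,
a WOUND under-walk has a PREFIX crossing at some edge `i` and an EXCURSION crossing at some LATER edge `k > i` (take the first
edge crossed by the excursion; the edges before it are not excursion mid-edges, so if none were a prefix mid-edge the parent's
separation lemma would fire). ★★★★★ `ΩG.AJ_root_eq_zero_of_cut` / `ΩG.WE_eq_excursionWinding_of_under_cut` — **THE ONE-LIVE-EDGE
CRITERION**: if all edges of such a cut but at most one are DEAD (a face absent), no class-`B2a` under-walk at the far cell is
wound (either orientation); `ΩG.sum_routeMassW_S_eq_zero_of_cut`. Every emptiness of the under route typed so far in the lane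
(thin side, dead door + floor, root notch + east ray, one live ray column, one live row, east shut) is the criterion for a
straight cut; bent cuts are new.
§3 BENT CUTS, BOXES (`lawL_box_…`, any further defects `S ∋ h` missing the far cell; `h` = hole, `w = (h.1 + 1, h.2)`, bottom
row `0`): ★★★★★ `lawL_box_rootS_killSE_h3_not_wound_under` — THREE rows below the hole (`h.2 = 3`), `rootS = (h.1 + 1, 2)` and
`K_S1 = (h.1 + 2, 1)` removed ⇒ NO WOUND UNDER-WALK (cut: east along `w.S` (dead), south along the west sides of `pocketSE`
(dead), `K_S1` (dead), `(h.1 + 2, 0)` (live), out); ★★★★★ `lawL_box_holeS_farSWS_h3_not_wound_under` — `h.2 = 3`, `holeS =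
(h.1, 2)` and `farSWS = (h.1 − 1, 1)` removed ⇒ NO WOUND UNDER-WALK (cut: west along the hole's bottom (dead), south along the
west sides of `holeS` (dead), `holeSS` (dead: `farSWS` absent), `(h.1, 0)` (live), out); ★★★★★
`lawL_box_rootS_killSE_eastCol_not_wound_under` — `rootE` in the second-to-last column (`h.1 + 4 = m`), `rootS` and `K_S1`
removed ⇒ NO WOUND UNDER-WALK (cut: `w.S`, `pocketSE.W`, `pocketSE.S` dead, then east along the bottom of `(h.1 + 3, h.2 − 1)`
(live), out). These are the three «T/T» cells of the lane's ring + near census (FINDING-YB-KILL-FORCED-ZEROS §27, kit j300087,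
frame `[0,6]×[−1,5]`: `{K_S1, rootS}` by two cuts, `{farSWS, holeS}`), decided: NONE — first as general-`D` statements
(`ΩG.WE_eq_excursionWinding_of_under_rootS_killSE_floor`, `…_of_under_holeS_farSWS_floor`, `…_of_under_rootS_killSE_eastWall`),
with their row-mirror twins for the OVER route (`…_of_over_rootN_killNE_ceiling`, `…_of_over_holeN_farNWN_ceiling`,
`…_of_over_rootN_killNE_eastWall`, by `ΩG.mirrorFar`) and the box twins (`h.2 + 4 = n`, resp. `h.1 + 4 = m`).

Not in print (the printed sources root walks on the outer boundary); venture lane «pcv-sawmu», seat b-step0 gen 29.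

References: R. Courant, H. Robbins, *What is Mathematics?* (1941/1958), Ch. V Appendix §2 (the Jordan curve theorem for
polygons: the even–odd rule, inside and outside, the order of a point) [CourantRobbins1958]; L. V. Ahlfors, *Complex Analysis*,
3rd ed. (1979), Ch. 4 §2.1 (the index of a point with respect to a closed curve: constancy on components, vanishing on the
unbounded one) [AhlforsCA1979]; A. Glazman, Electron. Commun. Probab. 20 (2015) no. 86, Lemma 3.1, proof pp. 6–7
[Glazman2015WeightedSAW]; A. Glazman, I. Manolescu, arXiv:1708.00395v3, §1, §2.1, Lemma 2.1 [GlazmanManolescu2019].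
-/

noncomputable section

open Set Function Complex
open Literature.Topology.PlaneTopology

namespace Literature.Probability.RandomPlanarGeometry.SAW.YangBaxter

open Real
open Literature.Barriers.CriticalPhenomena.PlaquetteWalk (mirrorRowFace)

open private fc_ne from Literature.Probability.RandomPlanarGeometry.YangBaxterSAWGeneralDomain

open private exit_eq_of_mem_edge_sideSeg wind_eq_of_segment_disjoint not_mem_range_of_forall exists_norm_le
  toC_cornerPt_not_mem_edge cross_vert cross_slant arc_coords len_eq side_jOut toC_midPt_side_mem_sideSeg
  from Literature.Probability.RandomPlanarGeometry.YangBaxterSAWExcursionJordan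

namespace ΩG

variable {D : Set Face} {w : Face} {ω : ΩG D (w.side .W) (farW w)}

/-! ## §1 The excursion side: live exits, transport of `AJ` along lattice sides, exit certificates, existence -/

/-- ★ **Every exit mid-edge of a slot of the excursion polygon is LIVE**: both its faces lie in `D` (for the last one, the
return side of the far cell: the far cell and the face of the walk's last arc).
[cite: Glazman2015WeightedSAW, Lemma 3.1 (proof, pp. 6–7: the classes of walks through a rhombus)] -/
theorem exit_faces_mem (hr : RootedFace D (w.side .W) (farW w)) (h : ω.IsB2a) {j : ℕ} (hj : j < ω.Mv) :
    ((ω.jFace h j).side (ω.jOut hr h j)).faces.1 ∈ D ∧ ((ω.jFace h j).side (ω.jOut hr h j)).faces.2 ∈ D := by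
  have hF := ω.fh_lt h
  have hM := ω.three_le_Mv hr h
  have hlen : ω.2.arcs.length = ω.2.firstHitG + ω.Mv := len_eq h
  rw [side_jOut (hr := hr) h hj]
  rcases Nat.lt_or_ge (ω.2.firstHitG + j + 1) ω.2.arcs.length with hlt | hge
  · exact ω.2.door_nth (j := ω.2.firstHitG + j + 1) (by omega) hlt
  · have heq : ω.2.firstHitG + j + 1 = ω.2.arcs.length := by omega
    obtain ⟨-, h2, -⟩ := ω.2.side_sIn_nth (i := ω.2.arcs.length - 1) (by omega)
    rw [show ω.2.arcs.length - 1 + 1 = ω.2.arcs.length by omega] at h2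
    rw [heq]
    exact door_of_two_faces ⟨_, h2⟩ ⟨ω.1, ω.2.nth_length.symm⟩
      (fc_ne ω hr h (by omega) (by omega)) (YBWalk.arcFace_arcAt (γ := ω.2) (by omega)).2 hr.mem

/-- The winding angle of `J` about a lattice corner is `2π` times its winding number there (corners are off `J`).
[cite: AhlforsCA1979, Ch. 4 §2.1 (index of a point with respect to a closed curve)] -/
theorem AJ_cornerPt_eq_two_pi_mul_wind (hr : RootedFace D (w.side .W) (farW w)) (h : ω.IsB2a) (q : ℤ × ℤ) :
    ω.AJ hr h (toC (cornerPt q)) = 2 * Real.pi * wind (fun t ↦ polygonLoop (ω.pJlist hr h) t - toC (cornerPt q)) :=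
  AJ_eq_two_pi_mul_wind h fun _ hk => toC_cornerPt_not_mem_edge h q hk

/-- ★ **Transport across one lattice side that is no exit mid-edge**: if the unit step from corner `q` to corner `q'` walks the
closed side `c.side s` and no slot of `J` exits through `c.side s`, then `AJ` is the same at the two corners.
[cite: AhlforsCA1979, Ch. 4 §2.1 (index of a point with respect to a closed curve)]
[cite: CourantRobbins1958, Ch. V Appendix §2 (The Jordan Curve Theorem for Polygons: the even–odd rule)] -/
theorem AJ_cornerPt_eq_of_step (hr : RootedFace D (w.side .W) (farW w)) (h : ω.IsB2a) {q q' : ℤ × ℤ} {c : Face}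
    {s : Side} (hseg : segment ℝ (toC (cornerPt q)) (toC (cornerPt q')) = sideSeg c s)
    (hfree : ∀ j, j < ω.Mv → (ω.jFace h j).side (ω.jOut hr h j) ≠ c.side s) :
    ω.AJ hr h (toC (cornerPt q)) = ω.AJ hr h (toC (cornerPt q')) := by
  rw [AJ_cornerPt_eq_two_pi_mul_wind hr h, AJ_cornerPt_eq_two_pi_mul_wind hr h]
  congr 1
  exact_mod_cast wind_eq_of_segment_disjoint h fun z hz k hk hzk => by
    rw [hseg] at hz
    obtain ⟨j, hj, -, he, -⟩ := exit_eq_of_mem_edge_sideSeg h hk hzk hz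
    exact hfree j hj he

/-- ★★ **TRANSPORT ALONG A LATTICE CHAIN**: corners `q 0, …, q K` joined by unit steps walking closed sides
`(c k).side (s k)`, none of which is an exit mid-edge of a slot ⇒ `AJ` is the same at all of them.
[cite: AhlforsCA1979, Ch. 4 §2.1 (index of a point with respect to a closed curve)]
[cite: CourantRobbins1958, Ch. V Appendix §2 (The Jordan Curve Theorem for Polygons: the even–odd rule)] -/
theorem AJ_cornerChain (hr : RootedFace D (w.side .W) (farW w)) (h : ω.IsB2a) {q : ℕ → ℤ × ℤ} {c : ℕ → Face}
    {s : ℕ → Side} {K : ℕ}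
    (hseg : ∀ k, k < K → segment ℝ (toC (cornerPt (q k))) (toC (cornerPt (q (k + 1)))) = sideSeg (c k) (s k))
    (hfree : ∀ k, k < K → ∀ j, j < ω.Mv → (ω.jFace h j).side (ω.jOut hr h j) ≠ (c k).side (s k)) :
    ∀ k, k ≤ K → ω.AJ hr h (toC (cornerPt (q k))) = ω.AJ hr h (toC (cornerPt (q 0))) := by
  intro k
  induction k with
  | zero => intro _; rfl
  | succ k ih =>
    intro hk
    rw [← ih (by omega)]
    exact (AJ_cornerPt_eq_of_step hr h (hseg k hk) (hfree k hk)).symm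

/-- ★★ **At the lower corner of the root edge `AJ` equals its value at the root's midpoint** (the lower half of the root edge
is off `J`: no slot exits through the root). [cite: AhlforsCA1979, Ch. 4 §2.1 (index of a point with respect to a closed curve)]
[cite: Glazman2015WeightedSAW, Lemma 3.1 (proof, pp. 6–7: the classes of walks through a rhombus)] -/
theorem AJ_cornerPt_root_eq_AJ_root (hr : RootedFace D (w.side .W) (farW w)) (h : ω.IsB2a) :
    ω.AJ hr h (toC (cornerPt w)) = ω.AJ hr h (toC (midPt (w.side .W))) := by
  -- the half root edge from its lower corner to its midpoint is off `J`
  have hsub : segment ℝ (toC (cornerPt w)) (toC (midPt (w.side .W))) ⊆ sideSeg w .W := by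
    refine (convex_segment _ _).segment_subset ?_ (toC_midPt_side_mem_sideSeg _ _)
    rw [← cLo_eq_toC_cornerPt]; exact left_mem_segment _ _ _
  have hoff : ∀ z ∈ segment ℝ (toC (cornerPt w)) (toC (midPt (w.side .W))), ∀ k < 2 * ω.Mv,
      z ∉ segment ℝ (ω.pJ hr h k) (ω.pJ hr h (k + 1)) := by
    intro z hz k hk hzk
    obtain ⟨j, hj, -, he, -⟩ := exit_eq_of_mem_edge_sideSeg h hk hzk (hsub hz)
    exact exit_ne_root (hr := hr) h hj he
  rw [AJ_cornerPt_eq_two_pi_mul_wind hr h,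
    AJ_eq_two_pi_mul_wind h fun k hk => hoff _ (right_mem_segment _ _ _) k hk]
  congr 1
  exact_mod_cast wind_eq_of_segment_disjoint h hoff

/-! ### Where `J` is drawn: coordinate bounds from the faces of the domain -/

/-- **Every point of the excursion polygon lies within one mesh unit of a face of `D`, horizontally**: if every face of
`D` has column `< X`, every point of `J` has real part `< 4X`. [cite: GlazmanManolescu2019, §1 (the lattice of rhombi, Fig. 1)] -/
theorem re_lt_of_mem_pJ_edge (hr : RootedFace D (w.side .W) (farW w)) (h : ω.IsB2a) {X : ℤ}
    (hD : ∀ f : Face, f ∈ D → f.1 < X) {k : ℕ} (hk : k < 2 * ω.Mv) {p : ℂ}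
    (hp : p ∈ segment ℝ (ω.pJ hr h k) (ω.pJ hr h (k + 1))) : p.re < 4 * X := by
  have hF := ω.fh_lt h
  have hlen : ω.2.arcs.length = ω.2.firstHitG + ω.Mv := len_eq h
  rcases mem_pJedge_cases hr h hk hp with ⟨j, hj, hc⟩ | ⟨j, hj1, hj, ha⟩ | ha
  · have hd := exit_faces_mem hr h hj
    rw [side_jOut (hr := hr) h hj] at hd
    revert hc hd
    cases ω.2.nth (ω.2.firstHitG + j + 1) with
    | vert a b =>
      intro hc hd
      obtain ⟨-, hx⟩ := cross_vert hc
      have := hD _ hd.2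
      simp only [MidEdge.faces] at this
      have hX : (a : ℝ) ≤ X - 1 := by exact_mod_cast (show a ≤ X - 1 by omega)
      rw [abs_le] at hx; linarith [hx.2]
    | slant a b =>
      intro hc hd
      obtain ⟨hx, -⟩ := cross_slant hc
      have := hD _ hd.2
      simp only [MidEdge.faces] at this
      have hX : (a : ℝ) ≤ X - 1 := by exact_mod_cast (show a ≤ X - 1 by omega)
      rw [hx]; linarith
  · obtain ⟨hx, -⟩ := arc_coords ha
    have := hD _ (YBWalk.arcFace_arcAt (γ := ω.2) (i := ω.2.firstHitG + j) (by omega)).2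
    have hX : ((ω.2.fc (ω.2.firstHitG + j)).1 : ℝ) ≤ X - 1 := by exact_mod_cast (show _ ≤ X - 1 by omega)
    rw [abs_le] at hx; linarith [hx.2]
  · obtain ⟨hx, -⟩ := arc_coords ha
    have := hD _ hr.mem
    have hX : (((farW w).1 : ℤ) : ℝ) ≤ X - 1 := by exact_mod_cast (show (farW w).1 ≤ X - 1 by omega)
    rw [abs_le] at hx; linarith [hx.2]

/-- Horizontal lower bound: if every face of `D` has column `≥ X`, every point of `J` has real part `> 4X`.
[cite: GlazmanManolescu2019, §1 (the lattice of rhombi, Fig. 1)] -/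
theorem lt_re_of_mem_pJ_edge (hr : RootedFace D (w.side .W) (farW w)) (h : ω.IsB2a) {X : ℤ}
    (hD : ∀ f : Face, f ∈ D → X ≤ f.1) {k : ℕ} (hk : k < 2 * ω.Mv) {p : ℂ}
    (hp : p ∈ segment ℝ (ω.pJ hr h k) (ω.pJ hr h (k + 1))) : 4 * X < p.re := by
  have hF := ω.fh_lt h
  have hlen : ω.2.arcs.length = ω.2.firstHitG + ω.Mv := len_eq h
  rcases mem_pJedge_cases hr h hk hp with ⟨j, hj, hc⟩ | ⟨j, hj1, hj, ha⟩ | ha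
  · have hd := exit_faces_mem hr h hj
    rw [side_jOut (hr := hr) h hj] at hd
    revert hc hd
    cases ω.2.nth (ω.2.firstHitG + j + 1) with
    | vert a b =>
      intro hc hd
      obtain ⟨-, hx⟩ := cross_vert hc
      have := hD _ hd.1
      simp only [MidEdge.faces] at this
      have hX : (X : ℝ) + 1 ≤ a := by exact_mod_cast (show X + 1 ≤ a by omega)
      rw [abs_le] at hx; linarith [hx.1]
    | slant a b =>
      intro hc hd
      obtain ⟨hx, -⟩ := cross_slant hc
      have := hD _ hd.2
      simp only [MidEdge.faces] at this
      have hX : (X : ℝ) ≤ a := by exact_mod_cast this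
      rw [hx]; linarith
  · obtain ⟨hx, -⟩ := arc_coords ha
    have := hD _ (YBWalk.arcFace_arcAt (γ := ω.2) (i := ω.2.firstHitG + j) (by omega)).2
    have hX : (X : ℝ) ≤ (ω.2.fc (ω.2.firstHitG + j)).1 := by exact_mod_cast this
    rw [abs_le] at hx; linarith [hx.1]
  · obtain ⟨hx, -⟩ := arc_coords ha
    have := hD _ hr.mem
    have hX : (X : ℝ) ≤ (((farW w).1 : ℤ) : ℝ) := by exact_mod_cast this
    rw [abs_le] at hx; linarith [hx.1]

/-- Vertical upper bound: if every face of `D` has row `< Y`, every point of `J` has imaginary part `< 4Y`.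
[cite: GlazmanManolescu2019, §1 (the lattice of rhombi, Fig. 1)] -/
theorem im_lt_of_mem_pJ_edge (hr : RootedFace D (w.side .W) (farW w)) (h : ω.IsB2a) {Y : ℤ}
    (hD : ∀ f : Face, f ∈ D → f.2 < Y) {k : ℕ} (hk : k < 2 * ω.Mv) {p : ℂ}
    (hp : p ∈ segment ℝ (ω.pJ hr h k) (ω.pJ hr h (k + 1))) : p.im < 4 * Y := by
  have hF := ω.fh_lt h
  have hlen : ω.2.arcs.length = ω.2.firstHitG + ω.Mv := len_eq h
  rcases mem_pJedge_cases hr h hk hp with ⟨j, hj, hc⟩ | ⟨j, hj1, hj, ha⟩ | ha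
  · have hd := exit_faces_mem hr h hj
    rw [side_jOut (hr := hr) h hj] at hd
    revert hc hd
    cases ω.2.nth (ω.2.firstHitG + j + 1) with
    | vert a b =>
      intro hc hd
      obtain ⟨hy, -⟩ := cross_vert hc
      have := hD _ hd.2
      simp only [MidEdge.faces] at this
      have hY : (b : ℝ) ≤ Y - 1 := by exact_mod_cast (show b ≤ Y - 1 by omega)
      rw [hy]; linarith
    | slant a b =>
      intro hc hd
      obtain ⟨-, hy⟩ := cross_slant hc
      have := hD _ hd.2
      simp only [MidEdge.faces] at this
      have hY : (b : ℝ) ≤ Y - 1 := by exact_mod_cast (show b ≤ Y - 1 by omega)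
      rw [abs_le] at hy; linarith [hy.2]
  · obtain ⟨-, hy, -⟩ := arc_coords ha
    have := hD _ (YBWalk.arcFace_arcAt (γ := ω.2) (i := ω.2.firstHitG + j) (by omega)).2
    have hY : ((ω.2.fc (ω.2.firstHitG + j)).2 : ℝ) ≤ Y - 1 := by exact_mod_cast (show _ ≤ Y - 1 by omega)
    rw [abs_le] at hy; linarith [hy.2]
  · obtain ⟨-, hy, -⟩ := arc_coords ha
    have := hD _ hr.mem
    have hY : (((farW w).2 : ℤ) : ℝ) ≤ Y - 1 := by exact_mod_cast (show (farW w).2 ≤ Y - 1 by omega)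
    rw [abs_le] at hy; linarith [hy.2]

/-- Vertical lower bound: if every face of `D` has row `≥ Y`, every point of `J` has imaginary part `> 4Y`.
[cite: GlazmanManolescu2019, §1 (the lattice of rhombi, Fig. 1)] -/
theorem lt_im_of_mem_pJ_edge (hr : RootedFace D (w.side .W) (farW w)) (h : ω.IsB2a) {Y : ℤ}
    (hD : ∀ f : Face, f ∈ D → Y ≤ f.2) {k : ℕ} (hk : k < 2 * ω.Mv) {p : ℂ}
    (hp : p ∈ segment ℝ (ω.pJ hr h k) (ω.pJ hr h (k + 1))) : 4 * Y < p.im := by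
  have hF := ω.fh_lt h
  have hlen : ω.2.arcs.length = ω.2.firstHitG + ω.Mv := len_eq h
  rcases mem_pJedge_cases hr h hk hp with ⟨j, hj, hc⟩ | ⟨j, hj1, hj, ha⟩ | ha
  · have hd := exit_faces_mem hr h hj
    rw [side_jOut (hr := hr) h hj] at hd
    revert hc hd
    cases ω.2.nth (ω.2.firstHitG + j + 1) with
    | vert a b =>
      intro hc hd
      obtain ⟨hy, -⟩ := cross_vert hc
      have := hD _ hd.2
      simp only [MidEdge.faces] at this
      have hY : (Y : ℝ) ≤ b := by exact_mod_cast this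
      rw [hy]; linarith
    | slant a b =>
      intro hc hd
      obtain ⟨-, hy⟩ := cross_slant hc
      have := hD _ hd.1
      simp only [MidEdge.faces] at this
      have hY : (Y : ℝ) + 1 ≤ b := by exact_mod_cast (show Y + 1 ≤ b by omega)
      rw [abs_le] at hy; linarith [hy.1]
  · obtain ⟨-, hy, -⟩ := arc_coords ha
    have := hD _ (YBWalk.arcFace_arcAt (γ := ω.2) (i := ω.2.firstHitG + j) (by omega)).2
    have hY : (Y : ℝ) ≤ (ω.2.fc (ω.2.firstHitG + j)).2 := by exact_mod_cast this
    rw [abs_le] at hy; linarith [hy.1]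
  · obtain ⟨-, hy, -⟩ := arc_coords ha
    have := hD _ hr.mem
    have hY : (Y : ℝ) ≤ (((farW w).2 : ℤ) : ℝ) := by exact_mod_cast this
    rw [abs_le] at hy; linarith [hy.1]

/-! ### Exit certificates: `AJ = 0` at the lattice corners beyond the domain -/

/-- **A lattice line missing `J` carries winding number `0`**: if every point of `J` differs from every point `p + t·v`
(`t ≥ 0`, `v ≠ 0`) of a closed half-line, the winding number of `J` about its endpoint `p` vanishes (transport to a point
of the half-line beyond the drawing, which is outside). [cite: AhlforsCA1979, Ch. 4 §2.1 (index of a point with respect to a closed curve)]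
[cite: CourantRobbins1958, Ch. V Appendix §2 (The Jordan Curve Theorem for Polygons: inside and outside)] -/
theorem wind_eq_zero_of_halfLine_free (hr : RootedFace D (w.side .W) (farW w)) (h : ω.IsB2a) {p v : ℂ} (hv : v ≠ 0)
    (hfree : ∀ t : ℝ, 0 ≤ t → ∀ k < 2 * ω.Mv, p + t • v ∉ segment ℝ (ω.pJ hr h k) (ω.pJ hr h (k + 1))) :
    wind (fun t ↦ polygonLoop (ω.pJlist hr h) t - p) = 0 := by
  have hJ := isJordanLoop_pJ (hr := hr) h
  obtain ⟨R, -, hR⟩ := exists_norm_le (hr := hr) h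
  -- a point of the half-line beyond the drawing
  set T : ℝ := (R + ‖p‖ + 1) / ‖v‖ with hT
  have hv' : 0 < ‖v‖ := norm_pos_iff.2 hv
  have hR0 : 0 ≤ R := (norm_nonneg _).trans (hR 0)
  have hT0 : 0 ≤ T := div_nonneg (by linarith [norm_nonneg p]) hv'.le
  set q : ℂ := p + T • v with hq
  have hqn : R < ‖q‖ := by
    have h1 : ‖T • v‖ = R + ‖p‖ + 1 := by
      rw [norm_smul, Real.norm_of_nonneg hT0, hT, div_mul_cancel₀ _ hv'.ne']
    have h2 : ‖T • v‖ ≤ ‖q‖ + ‖p‖ := by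
      have : T • v = q - p := by rw [hq]; ring
      rw [this]; exact norm_sub_le q p
    linarith
  -- transport along the segment `[p, q]`, which lies on the half-line
  have hseg : ∀ z ∈ segment ℝ p q, ∀ k < 2 * ω.Mv, z ∉ segment ℝ (ω.pJ hr h k) (ω.pJ hr h (k + 1)) := by
    intro z hz k hk
    rw [segment_eq_image_lineMap] at hz
    obtain ⟨u, ⟨hu0, hu1⟩, rfl⟩ := hz
    have : AffineMap.lineMap p q u = p + (u * T) • v := by
      rw [AffineMap.lineMap_apply_module', hq]; simp only [add_sub_cancel_left, smul_smul]; ring_nf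
    rw [this]
    exact hfree (u * T) (mul_nonneg hu0 hT0) k hk
  rw [wind_eq_of_segment_disjoint h hseg]
  -- `q` is off `J` and not inside: outside, winding number `0`
  have hqJ : q ∉ range (polygonLoop (ω.pJlist hr h)) :=
    not_mem_range_of_forall h fun k hk => hseg q (right_mem_segment _ _ _) k hk
  rcases IsJordanLoop.mem_inside_or_mem_outside hqJ with hin | hout
  · exfalso
    have := hJ.norm_lt_of_mem_inside hR hin
    linarith
  · exact (hJ.mem_outside_iff_wind_eq_zero hqJ).1 hout

/-- ★★ **EXIT CERTIFICATE, EAST**: if every face of `D` lies strictly west of column `q.1`, then `AJ = 0` at the lattice corner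
`q` (the vertical lattice line through it misses `J`). [cite: AhlforsCA1979, Ch. 4 §2.1 (index of a point with respect to a closed curve)]
[cite: CourantRobbins1958, Ch. V Appendix §2 (The Jordan Curve Theorem for Polygons: inside and outside)] -/
theorem AJ_cornerPt_eq_zero_of_east (hr : RootedFace D (w.side .W) (farW w)) (h : ω.IsB2a) {q : ℤ × ℤ}
    (hD : ∀ f : Face, f ∈ D → f.1 < q.1) : ω.AJ hr h (toC (cornerPt q)) = 0 := by
  rw [AJ_cornerPt_eq_two_pi_mul_wind hr h, mul_eq_zero]
  refine Or.inr ?_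
  exact_mod_cast wind_eq_zero_of_halfLine_free hr h (v := I) I_ne_zero fun t _ k hk hz => by
    have := re_lt_of_mem_pJ_edge hr h hD hk hz
    simp [toC, cornerPt] at this

/-- ★★ **EXIT CERTIFICATE, WEST**: every face of `D` in columns `≥ q.1` ⇒ `AJ = 0` at the corner `q`.
[cite: AhlforsCA1979, Ch. 4 §2.1 (index of a point with respect to a closed curve)]
[cite: CourantRobbins1958, Ch. V Appendix §2 (The Jordan Curve Theorem for Polygons: inside and outside)] -/
theorem AJ_cornerPt_eq_zero_of_west (hr : RootedFace D (w.side .W) (farW w)) (h : ω.IsB2a) {q : ℤ × ℤ}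
    (hD : ∀ f : Face, f ∈ D → q.1 ≤ f.1) : ω.AJ hr h (toC (cornerPt q)) = 0 := by
  rw [AJ_cornerPt_eq_two_pi_mul_wind hr h, mul_eq_zero]
  refine Or.inr ?_
  exact_mod_cast wind_eq_zero_of_halfLine_free hr h (v := I) I_ne_zero fun t _ k hk hz => by
    have := lt_re_of_mem_pJ_edge hr h hD hk hz
    simp [toC, cornerPt] at this

/-- ★★ **EXIT CERTIFICATE, SOUTH**: every face of `D` in rows `≥ q.2` ⇒ `AJ = 0` at the corner `q`.
[cite: AhlforsCA1979, Ch. 4 §2.1 (index of a point with respect to a closed curve)]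
[cite: CourantRobbins1958, Ch. V Appendix §2 (The Jordan Curve Theorem for Polygons: inside and outside)] -/
theorem AJ_cornerPt_eq_zero_of_south (hr : RootedFace D (w.side .W) (farW w)) (h : ω.IsB2a) {q : ℤ × ℤ}
    (hD : ∀ f : Face, f ∈ D → q.2 ≤ f.2) : ω.AJ hr h (toC (cornerPt q)) = 0 := by
  rw [AJ_cornerPt_eq_two_pi_mul_wind hr h, mul_eq_zero]
  refine Or.inr ?_
  exact_mod_cast wind_eq_zero_of_halfLine_free hr h (v := 1) one_ne_zero fun t _ k hk hz => by
    have := lt_im_of_mem_pJ_edge hr h hD hk hz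
    simp [toC, cornerPt] at this

/-- ★★ **EXIT CERTIFICATE, NORTH**: every face of `D` in rows `< q.2` ⇒ `AJ = 0` at the corner `q`.
[cite: AhlforsCA1979, Ch. 4 §2.1 (index of a point with respect to a closed curve)]
[cite: CourantRobbins1958, Ch. V Appendix §2 (The Jordan Curve Theorem for Polygons: inside and outside)] -/
theorem AJ_cornerPt_eq_zero_of_north (hr : RootedFace D (w.side .W) (farW w)) (h : ω.IsB2a) {q : ℤ × ℤ}
    (hD : ∀ f : Face, f ∈ D → f.2 < q.2) : ω.AJ hr h (toC (cornerPt q)) = 0 := by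
  rw [AJ_cornerPt_eq_two_pi_mul_wind hr h, mul_eq_zero]
  refine Or.inr ?_
  exact_mod_cast wind_eq_zero_of_halfLine_free hr h (v := 1) one_ne_zero fun t _ k hk hz => by
    have := im_lt_of_mem_pJ_edge hr h hD hk hz
    simp [toC, cornerPt] at this

/-! ### Existence of an excursion crossing on every cut -/

/-- ★★★ **A WINDING EXCURSION CROSSES EVERY CUT.** If `J` winds around the root (`AJ ≠ 0` at the root's midpoint), every
lattice chain of unit steps from the lower corner of the root edge `q 0 = (w.1, w.2)` to a corner `q K` with `AJ = 0` has an
edge `(c k).side (s k)`, `k < K`, through which some slot of `J` exits — and a FIRST such edge.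
[cite: CourantRobbins1958, Ch. V Appendix §2 (The Jordan Curve Theorem for Polygons: the even–odd rule)]
[cite: AhlforsCA1979, Ch. 4 §2.1 (index of a point with respect to a closed curve)] -/
theorem exists_exit_on_cornerChain_of_AJ_ne_zero (hr : RootedFace D (w.side .W) (farW w)) (h : ω.IsB2a)
    {q : ℕ → ℤ × ℤ} {c : ℕ → Face} {s : ℕ → Side} {K : ℕ} (hq0 : q 0 = w)
    (hseg : ∀ k, k < K → segment ℝ (toC (cornerPt (q k))) (toC (cornerPt (q (k + 1)))) = sideSeg (c k) (s k))
    (hend : ω.AJ hr h (toC (cornerPt (q K))) = 0) (hA : ω.AJ hr h (toC (midPt (w.side .W))) ≠ 0) :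
    ∃ k, k < K ∧ (∃ j, j < ω.Mv ∧ (ω.jFace h j).side (ω.jOut hr h j) = (c k).side (s k)) ∧
      ∀ k', k' < k → ∀ j, j < ω.Mv → (ω.jFace h j).side (ω.jOut hr h j) ≠ (c k').side (s k') := by
  classical
  by_contra hno
  push Not at hno
  -- by strong induction every prefix of the chain is exit-free
  have hall : ∀ k, k < K → ∀ j, j < ω.Mv → (ω.jFace h j).side (ω.jOut hr h j) ≠ (c k).side (s k) := by
    intro k
    induction k using Nat.strong_induction_on with
    | _ k ih =>
      intro hk j hj he
      obtain ⟨k', hk', j', hj', he'⟩ := hno k hk ⟨j, hj, he⟩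
      exact ih k' hk' (by omega) j' hj' he'
  have e := AJ_cornerChain hr h hseg hall K le_rfl
  rw [hend, hq0, AJ_cornerPt_root_eq_AJ_root hr h] at e
  exact hA e.symm

/-! ## §2 The cut law for under-walks and the one-live-edge criterion -/

/-- ★★★★★ **THE CUT LAW.** Hole absent; `ω` a class-`B2a` UNDER-walk at the far cell (first side `S`) whose excursion polygon
winds around the root; a lattice cut `q 0 = (w.1, w.2), …, q K` with `AJ = 0` at its last corner, whose edges are neither the
hole's `W` side nor the root edge. Then for some `i < k < K` the PREFIX crosses the `i`-th edge (`nth i' = (c i).side (s i)`,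
`1 ≤ i' ≤ F`) and a slot of the EXCURSION polygon exits through the `k`-th edge — two distinct live edges of the cut, the
prefix's strictly before the excursion's first one.
[cite: CourantRobbins1958, Ch. V Appendix §2 (The Jordan Curve Theorem for Polygons: the even–odd rule)]
[cite: AhlforsCA1979, Ch. 4 §2.1 (index of a point with respect to a closed curve)]
[cite: Glazman2015WeightedSAW, Lemma 3.1 (proof, pp. 6–7: the classes of walks through a rhombus)] -/
theorem exists_prefix_lt_exit_on_cut (hh : holeFaceW w ∉ D) (hr : RootedFace D (w.side .W) (farW w)) (h : ω.IsB2a)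
    (hS : ω.2.firstSideG = .S) {q : ℕ → ℤ × ℤ} {c : ℕ → Face} {s : ℕ → Side} {K : ℕ} (hq0 : q 0 = w)
    (hseg : ∀ k, k < K → segment ℝ (toC (cornerPt (q k))) (toC (cornerPt (q (k + 1)))) = sideSeg (c k) (s k))
    (h1 : ∀ k, k < K → (c k).side (s k) ≠ (holeFaceW w).side .W) (h2 : ∀ k, k < K → (c k).side (s k) ≠ w.side .W)
    (hend : ω.AJ hr h (toC (cornerPt (q K))) = 0) (hA : ω.AJ hr h (toC (midPt (w.side .W))) ≠ 0) :
    ∃ i k, i < k ∧ k < K ∧ (∃ i', 1 ≤ i' ∧ i' ≤ ω.2.firstHitG ∧ ω.2.nth i' = (c i).side (s i)) ∧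
      ∃ j, j < ω.Mv ∧ (ω.jFace h j).side (ω.jOut hr h j) = (c k).side (s k) := by
  obtain ⟨k, hk, hJ, -⟩ := exists_exit_on_cornerChain_of_AJ_ne_zero hr h hq0 hseg hend hA
  by_contra hno
  push Not at hno
  -- no prefix crossing before `k`: the parent's separation lemma fires on the sub-chain `q 0, …, q k`
  refine false_of_free_chain_exit hh hr h hS (P := fun k' => toC (cornerPt (q k'))) (c := c) (s := s) (K := k)
    (by show toC (cornerPt (q 0)) = cLo w; rw [hq0, cLo_eq_toC_cornerPt]) (fun k' hk' => (hseg k' (by omega)).le)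
    (fun k' hk' => h1 k' (by omega)) (fun k' hk' => h2 k' (by omega)) (fun k' hk' i' hi1 hiF e => ?_)
    (c' := c k) (s' := s k) ?_ hJ
  · obtain ⟨j, hj, hje⟩ := hJ
    exact hno k' k hk' hk ⟨i', hi1, hiF, e⟩ j hj hje
  · show toC (cornerPt (q k)) ∈ sideSeg (c k) (s k)
    rw [← hseg k hk]; exact left_mem_segment _ _ _

/-- The four exit certificates in one: a corner beyond the domain in one of the four axis directions has `AJ = 0`.
[cite: AhlforsCA1979, Ch. 4 §2.1 (index of a point with respect to a closed curve)]
[cite: CourantRobbins1958, Ch. V Appendix §2 (The Jordan Curve Theorem for Polygons: inside and outside)] -/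
theorem AJ_cornerPt_eq_zero_of_beyond (hr : RootedFace D (w.side .W) (farW w)) (h : ω.IsB2a) {q : ℤ × ℤ}
    (hD : (∀ f : Face, f ∈ D → f.1 < q.1) ∨ (∀ f : Face, f ∈ D → q.1 ≤ f.1) ∨ (∀ f : Face, f ∈ D → q.2 ≤ f.2) ∨
      (∀ f : Face, f ∈ D → f.2 < q.2)) : ω.AJ hr h (toC (cornerPt q)) = 0 := by
  rcases hD with hD | hD | hD | hD
  · exact AJ_cornerPt_eq_zero_of_east hr h hD
  · exact AJ_cornerPt_eq_zero_of_west hr h hD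
  · exact AJ_cornerPt_eq_zero_of_south hr h hD
  · exact AJ_cornerPt_eq_zero_of_north hr h hD

/-- ★★★★★ **THE ONE-LIVE-EDGE CRITERION.** Hole absent; a lattice cut `q 0 = (w.1, w.2), …, q K` ending beyond the domain
(in one of the four axis directions), whose edges are neither the hole's `W` side nor the root edge, and NO TWO of whose edges
`k < k'` are both live (one of the two has a face outside `D`). Then the excursion polygon of every class-`B2a` UNDER-walk at
the far cell does not wind around the root. [cite: CourantRobbins1958, Ch. V Appendix §2 (the even–odd rule)]
[cite: AhlforsCA1979, Ch. 4 §2.1 (index of a point)] [cite: Glazman2015WeightedSAW, Lemma 3.1 (proof, pp. 6–7)] -/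
theorem AJ_root_eq_zero_of_cut (hh : holeFaceW w ∉ D) {q : ℕ → ℤ × ℤ} {c : ℕ → Face} {s : ℕ → Side} {K : ℕ}
    (hq0 : q 0 = w)
    (hseg : ∀ k, k < K → segment ℝ (toC (cornerPt (q k))) (toC (cornerPt (q (k + 1)))) = sideSeg (c k) (s k))
    (h1 : ∀ k, k < K → (c k).side (s k) ≠ (holeFaceW w).side .W) (h2 : ∀ k, k < K → (c k).side (s k) ≠ w.side .W)
    (hexit : (∀ f : Face, f ∈ D → f.1 < (q K).1) ∨ (∀ f : Face, f ∈ D → (q K).1 ≤ f.1) ∨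
      (∀ f : Face, f ∈ D → (q K).2 ≤ f.2) ∨ (∀ f : Face, f ∈ D → f.2 < (q K).2))
    (hdead : ∀ k k', k < k' → k' < K →
      (((c k).side (s k)).faces.1 ∉ D ∨ ((c k).side (s k)).faces.2 ∉ D) ∨
        (((c k').side (s k')).faces.1 ∉ D ∨ ((c k').side (s k')).faces.2 ∉ D))
    (ω : ΩG D (w.side .W) (farW w)) (hr : RootedFace D (w.side .W) (farW w)) (h : ω.IsB2a)
    (hS : ω.2.firstSideG = .S) : ω.AJ hr h (toC (midPt (w.side .W))) = 0 := by
  by_contra hA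
  have hF := ω.fh_lt h
  obtain ⟨i, k, hik, hk, ⟨i', hi1, hiF, e⟩, j, hj, e'⟩ :=
    exists_prefix_lt_exit_on_cut hh hr h hS hq0 hseg h1 h2 (AJ_cornerPt_eq_zero_of_beyond hr h hexit) hA
  have hl1 := ω.2.door_nth (j := i') (by omega) (by omega)
  rw [e] at hl1
  have hl2 := exit_faces_mem hr h hj
  rw [e'] at hl2
  rcases hdead i k hik hk with (hd | hd) | (hd | hd)
  · exact hd hl1.1
  · exact hd hl1.2
  · exact hd hl2.1
  · exact hd hl2.2

/-- ★★★★★ **THE ONE-LIVE-EDGE CRITERION, winding form**: under the hypotheses of `AJ_root_eq_zero_of_cut`, every class-`B2a`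
under-walk at the far cell has its Yang–Baxter winding equal to the excursion winding (either orientation of the witness).
[cite: GlazmanManolescu2019, Lemma 2.1 (statement, "in the form given in [Gl]"), §1 (Fig. 2)]
[cite: Glazman2015WeightedSAW, Lemma 3.1 (proof, pp. 6–7)] [cite: CourantRobbins1958, Ch. V Appendix §2 (the even–odd rule)] -/
theorem WE_eq_excursionWinding_of_under_cut (hh : holeFaceW w ∉ D) {q : ℕ → ℤ × ℤ} {c : ℕ → Face} {s : ℕ → Side}
    {K : ℕ} (hq0 : q 0 = w)
    (hseg : ∀ k, k < K → segment ℝ (toC (cornerPt (q k))) (toC (cornerPt (q (k + 1)))) = sideSeg (c k) (s k))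
    (h1 : ∀ k, k < K → (c k).side (s k) ≠ (holeFaceW w).side .W) (h2 : ∀ k, k < K → (c k).side (s k) ≠ w.side .W)
    (hexit : (∀ f : Face, f ∈ D → f.1 < (q K).1) ∨ (∀ f : Face, f ∈ D → (q K).1 ≤ f.1) ∨
      (∀ f : Face, f ∈ D → (q K).2 ≤ f.2) ∨ (∀ f : Face, f ∈ D → f.2 < (q K).2))
    (hdead : ∀ k k', k < k' → k' < K →
      (((c k).side (s k)).faces.1 ∉ D ∨ ((c k).side (s k)).faces.2 ∉ D) ∨
        (((c k').side (s k')).faces.1 ∉ D ∨ ((c k').side (s k')).faces.2 ∉ D))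
    (ω : ΩG D (w.side .W) (farW w)) (hr : RootedFace D (w.side .W) (farW w)) (h : ω.IsB2a)
    (hS : ω.2.firstSideG = .S) (θ : ℝ) :
    ω.WE (fun _ => θ) = excursionWinding θ ω.2.firstSideG (ω.z1 hr h) ω.1 := by
  by_contra hW
  rcases ω.AJ_ne_zero_or_rev_of_wound hr h θ hW with hA | hA
  · exact hA (AJ_root_eq_zero_of_cut hh hq0 hseg h1 h2 hexit hdead ω hr h hS)
  · have h' := ω.rev_isB2a hr h
    have hS' : (ω.rev hr).2.firstSideG = .S := by rw [ω.rev_firstSide hr h]; exact hS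
    exact hA (AJ_root_eq_zero_of_cut hh hq0 hseg h1 h2 hexit hdead (ω.rev hr) hr h' hS')

/-! ## §3 Three bent cuts: the root notch with the corner cell, and the far cell's lower pocket -/

/-- ★★★★★ **ROOT NOTCH + CORNER CELL, FLOOR THREE ROWS DOWN ⇒ NO WOUND UNDER-WALK.** Hole, `rootS w = (w.1, w.2 − 1)` and
`killSE w = (w.1 + 1, w.2 − 2)` absent, and no face of `D` below row `w.2 − 3`. Cut: east along `w.S` (dead), south along the
west sides of `pocketSE` (dead), of `killSE` (dead) and of `(w.1 + 1, w.2 − 3)` (the one possibly live edge), out through the floor.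
(The lane's kit j300087: `{K_S1, rootS}` in `[0,6]×[−1,5]`, under witnesses TIMEOUT — decided: none.)
[cite: GlazmanManolescu2019, Lemma 2.1 (statement, "in the form given in [Gl]"), §1 (Fig. 2)]
[cite: Glazman2015WeightedSAW, Lemma 3.1 (proof, pp. 6–7)] [cite: CourantRobbins1958, Ch. V Appendix §2 (the even–odd rule)] -/
theorem WE_eq_excursionWinding_of_under_rootS_killSE_floor (hh : holeFaceW w ∉ D) (hRS : rootS w ∉ D)
    (hK : killSE w ∉ D) (hfloor : ∀ f : Face, f ∈ D → w.2 - 3 ≤ f.2)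
    (ω : ΩG D (w.side .W) (farW w)) (hr : RootedFace D (w.side .W) (farW w)) (h : ω.IsB2a)
    (hS : ω.2.firstSideG = .S) (θ : ℝ) :
    ω.WE (fun _ => θ) = excursionWinding θ ω.2.firstSideG (ω.z1 hr h) ω.1 := by
  refine WE_eq_excursionWinding_of_under_cut hh (q := fun k => (w.1 + min (k : ℤ) 1, w.2 - ((k - 1 : ℕ) : ℤ)))
    (c := fun k => if k = 0 then w else (w.1 + 1, w.2 - k)) (s := fun k => if k = 0 then Side.S else Side.W) (K := 4)
    (by simp) (fun k hk => ?_) (fun k hk => ?_) (fun k hk => ?_) (Or.inr (Or.inr (Or.inl fun f hf => ?_)))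
    (fun k k' hkk' hk' => ?_) ω hr h hS θ
  · interval_cases k
    · simpa using segment_cornerPt_east ((w.1, w.2) : ℤ × ℤ)
    · simpa using segment_cornerPt_south ((w.1 + 1, w.2) : ℤ × ℤ)
    · have := segment_cornerPt_south ((w.1 + 1, w.2 - 1) : ℤ × ℤ)
      simp only [Nat.cast_ofNat, show (2 - 1 : ℕ) = 1 from rfl, Nat.cast_one] at this ⊢
      rw [show w.2 - 1 - 1 = w.2 - 2 by ring] at this
      simpa using this
    · have := segment_cornerPt_south ((w.1 + 1, w.2 - 2) : ℤ × ℤ)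
      simp only [Nat.cast_ofNat, show (3 - 1 : ℕ) = 2 from rfl] at this ⊢
      rw [show w.2 - 2 - 1 = w.2 - 3 by ring] at this
      simpa using this
  · interval_cases k <;> (obtain ⟨a, b⟩ := w; simp [holeFaceW, Face.side])
  · interval_cases k <;> (obtain ⟨a, b⟩ := w; simp [Face.side])
  · have := hfloor f hf; simp only [Nat.cast_ofNat, show (4 - 1 : ℕ) = 3 from rfl] ; omega
  · left
    have hk3 : k < 3 := by omega
    interval_cases k
    · left; simpa [Face.side, MidEdge.faces, rootS] using hRS
    · left
      have e : rootS w = (w.1 + 1 - 1, w.2 - 1) := by obtain ⟨a, b⟩ := w; simp [rootS]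
      simpa [Face.side, MidEdge.faces, e] using hRS
    · right
      have e : killSE w = (w.1 + 1, w.2 - 2) := by obtain ⟨a, b⟩ := w; simp [killSE]
      simpa [Face.side, MidEdge.faces, e] using hK

/-- ★★★★★ **`holeS` AND THE CELL TWO BELOW THE FAR CELL ABSENT, FLOOR THREE ROWS DOWN ⇒ NO WOUND UNDER-WALK.** Hole,
`(w.1 − 1, w.2 − 1)` (`holeS`) and `(w.1 − 2, w.2 − 2)` (`farSWS`) absent, no face of `D` below row `w.2 − 3`. Cut: west along the
hole's bottom side (dead), south along the west sides of `holeS` (dead), of `holeSS = (w.1 − 1, w.2 − 2)` (dead: its western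
neighbour is `farSWS`) and of `(w.1 − 1, w.2 − 3)` (the one possibly live edge), out through the floor. (Kit j300087:
`{farSWS, holeS}` in `[0,6]×[−1,5]`, under witnesses TIMEOUT — decided: none.)
[cite: GlazmanManolescu2019, Lemma 2.1 (statement, "in the form given in [Gl]"), §1 (Fig. 2)]
[cite: Glazman2015WeightedSAW, Lemma 3.1 (proof, pp. 6–7)] [cite: CourantRobbins1958, Ch. V Appendix §2 (the even–odd rule)] -/
theorem WE_eq_excursionWinding_of_under_holeS_farSWS_floor (hh : holeFaceW w ∉ D)
    (hHS : ((w.1 - 1, w.2 - 1) : Face) ∉ D) (hFS : ((w.1 - 2, w.2 - 2) : Face) ∉ D)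
    (hfloor : ∀ f : Face, f ∈ D → w.2 - 3 ≤ f.2)
    (ω : ΩG D (w.side .W) (farW w)) (hr : RootedFace D (w.side .W) (farW w)) (h : ω.IsB2a)
    (hS : ω.2.firstSideG = .S) (θ : ℝ) :
    ω.WE (fun _ => θ) = excursionWinding θ ω.2.firstSideG (ω.z1 hr h) ω.1 := by
  refine WE_eq_excursionWinding_of_under_cut hh (q := fun k => (w.1 - min (k : ℤ) 1, w.2 - ((k - 1 : ℕ) : ℤ)))
    (c := fun k => if k = 0 then (w.1 - 1, w.2) else (w.1 - 1, w.2 - k))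
    (s := fun k => if k = 0 then Side.S else Side.W) (K := 4)
    (by simp) (fun k hk => ?_) (fun k hk => ?_) (fun k hk => ?_) (Or.inr (Or.inr (Or.inl fun f hf => ?_)))
    (fun k k' hkk' hk' => ?_) ω hr h hS θ
  · interval_cases k
    · simpa using segment_cornerPt_west ((w.1, w.2) : ℤ × ℤ)
    · simpa using segment_cornerPt_south ((w.1 - 1, w.2) : ℤ × ℤ)
    · have := segment_cornerPt_south ((w.1 - 1, w.2 - 1) : ℤ × ℤ)
      simp only [Nat.cast_ofNat, show (2 - 1 : ℕ) = 1 from rfl, Nat.cast_one] at this ⊢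
      rw [show w.2 - 1 - 1 = w.2 - 2 by ring] at this
      simpa using this
    · have := segment_cornerPt_south ((w.1 - 1, w.2 - 2) : ℤ × ℤ)
      simp only [Nat.cast_ofNat, show (3 - 1 : ℕ) = 2 from rfl] at this ⊢
      rw [show w.2 - 2 - 1 = w.2 - 3 by ring] at this
      simpa using this
  · interval_cases k <;> (obtain ⟨a, b⟩ := w; simp [holeFaceW, Face.side])
  · interval_cases k <;> (obtain ⟨a, b⟩ := w; simp [Face.side])
  · have := hfloor f hf; simp only [Nat.cast_ofNat, show (4 - 1 : ℕ) = 3 from rfl] ; omega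
  · left
    have hk3 : k < 3 := by omega
    interval_cases k
    · right
      have e : holeFaceW w = (w.1 - 1, w.2) := by obtain ⟨a, b⟩ := w; simp [holeFaceW]
      simpa [Face.side, MidEdge.faces, e] using hh
    · right; simpa [Face.side, MidEdge.faces] using hHS
    · left
      have e : ((w.1 - 2, w.2 - 2) : Face) = (w.1 - 1 - 1, w.2 - 2) := Prod.ext (by simp only; ring) rfl
      simpa [Face.side, MidEdge.faces, e] using hFS

/-- ★★★★★ **ROOT NOTCH + CORNER CELL, EAST WALL TWO COLUMNS BEYOND THE ROOT PLAQUETTE ⇒ NO WOUND UNDER-WALK.** Hole, `rootS w`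
and `killSE w` absent, no face of `D` in the columns `≥ w.1 + 3`. Cut: east along `w.S` (dead), south along the west side of
`pocketSE` (dead), east along the bottom sides of `pocketSE` (dead: the cell below is `killSE`) and of `(w.1 + 2, w.2 − 1)` (the one
possibly live edge), out through the east wall. (Kit j300087: the same `{K_S1, rootS}` cell, second cut.)
[cite: GlazmanManolescu2019, Lemma 2.1 (statement, "in the form given in [Gl]"), §1 (Fig. 2)]
[cite: Glazman2015WeightedSAW, Lemma 3.1 (proof, pp. 6–7)] [cite: CourantRobbins1958, Ch. V Appendix §2 (the even–odd rule)] -/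
theorem WE_eq_excursionWinding_of_under_rootS_killSE_eastWall (hh : holeFaceW w ∉ D) (hRS : rootS w ∉ D)
    (hK : killSE w ∉ D) (heast : ∀ f : Face, f ∈ D → f.1 < w.1 + 3)
    (ω : ΩG D (w.side .W) (farW w)) (hr : RootedFace D (w.side .W) (farW w)) (h : ω.IsB2a)
    (hS : ω.2.firstSideG = .S) (θ : ℝ) :
    ω.WE (fun _ => θ) = excursionWinding θ ω.2.firstSideG (ω.z1 hr h) ω.1 := by
  refine WE_eq_excursionWinding_of_under_cut hh
    (q := fun k => if k = 0 then (w.1, w.2) else if k = 1 then (w.1 + 1, w.2) else (w.1 + ((k - 1 : ℕ) : ℤ), w.2 - 1))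
    (c := fun k => if k = 0 then w else if k = 1 then (w.1 + 1, w.2 - 1) else (w.1 + ((k - 1 : ℕ) : ℤ), w.2 - 1))
    (s := fun k => if k = 1 then Side.W else Side.S) (K := 4)
    (by simp) (fun k hk => ?_) (fun k hk => ?_) (fun k hk => ?_) (Or.inl fun f hf => ?_)
    (fun k k' hkk' hk' => ?_) ω hr h hS θ
  · interval_cases k
    · simpa using segment_cornerPt_east ((w.1, w.2) : ℤ × ℤ)
    · have := segment_cornerPt_south ((w.1 + 1, w.2) : ℤ × ℤ)
      norm_num at this ⊢
      exact this
    · have := segment_cornerPt_east ((w.1 + 1, w.2 - 1) : ℤ × ℤ)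
      norm_num at this ⊢
      rw [show w.1 + 1 + 1 = w.1 + 2 by ring] at this
      exact this
    · have := segment_cornerPt_east ((w.1 + 2, w.2 - 1) : ℤ × ℤ)
      norm_num at this ⊢
      rw [show w.1 + 2 + 1 = w.1 + 3 by ring] at this
      exact this
  · interval_cases k <;> (obtain ⟨a, b⟩ := w; simp [holeFaceW, Face.side])
  · interval_cases k <;> (obtain ⟨a, b⟩ := w; simp [Face.side]; try omega)
  · have := heast f hf
    simp only [show (4 : ℕ) ≠ 0 from by decide, show (4 : ℕ) ≠ 1 from by decide, if_false,
      show ((4 - 1 : ℕ) : ℤ) = 3 by norm_num]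
    omega
  · left
    have hk3 : k < 3 := by omega
    interval_cases k
    · left; simpa [Face.side, MidEdge.faces, rootS] using hRS
    · left
      have e : rootS w = (w.1 + 1 - 1, w.2 - 1) := by obtain ⟨a, b⟩ := w; simp [rootS]
      simpa [Face.side, MidEdge.faces, e] using hRS
    · left
      have e : killSE w = (w.1 + ((2 - 1 : ℕ) : ℤ), w.2 - 1 - 1) :=
        Prod.ext (by simp only [killSE]; norm_num) (by simp only [killSE]; ring)
      simpa [Face.side, MidEdge.faces, e] using hK

/-! ### The row-mirror twins: over-walks -/

/-- The reflection in the root row on a cell, in coordinates. [cite: GlazmanManolescu2019, §4.2 (lattice symmetries)] -/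
private theorem mirrorRowFace_mkCL (w : Face) (x y : ℤ) : mirrorRowFace w.2 ((x, y) : Face) = (x, 2 * w.2 - y) := by
  simp [mirrorRowFace]

/-- ★★★★★ **TWIN: `rootN` AND `killNE = (w.1 + 1, w.2 + 2)` ABSENT, CEILING THREE ROWS UP ⇒ NO WOUND OVER-WALK** (no face of `D`
above row `w.2 + 3`; row mirror of `…_of_under_rootS_killSE_floor`).
[cite: GlazmanManolescu2019, §1 (Fig. 1, Fig. 2), §4.2 (lattice symmetries), Lemma 2.1]
[cite: Glazman2015WeightedSAW, Lemma 3.1 (proof, pp. 6–7)] [cite: CourantRobbins1958, Ch. V Appendix §2 (the even–odd rule)] -/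
theorem WE_eq_excursionWinding_of_over_rootN_killNE_ceiling (hh : holeFaceW w ∉ D) (hRN : rootN w ∉ D)
    (hK : killNE w ∉ D) (hceil : ∀ f : Face, f ∈ D → f.2 ≤ w.2 + 3)
    (ω : ΩG D (w.side .W) (farW w)) (hr : RootedFace D (w.side .W) (farW w)) (h : ω.IsB2a)
    (hN : ω.2.firstSideG = .N) (θ : ℝ) :
    ω.WE (fun _ => θ) = excursionWinding θ ω.2.firstSideG (ω.z1 hr h) ω.1 := by
  by_contra hW
  have hr' := rootedFace_rowMirrorDom w hr
  have h' := ω.mirrorFar_isB2a hr h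
  have hh' : holeFaceW w ∉ rowMirrorDom w D := by rwa [mem_rowMirrorDom, mirrorRowFace_holeFaceW]
  have hRS' : rootS w ∉ rowMirrorDom w D := by rwa [mem_rowMirrorDom, mirrorRowFace_rootS]
  have hK' : killSE w ∉ rowMirrorDom w D := by rwa [mem_rowMirrorDom, mirrorRowFace_killSE]
  have hfloor' : ∀ f : Face, f ∈ rowMirrorDom w D → w.2 - 3 ≤ f.2 := by
    intro f hf
    rw [mem_rowMirrorDom] at hf
    have := hceil _ hf
    obtain ⟨x, y⟩ := f
    rw [mirrorRowFace_mkCL] at this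
    simp only at this ⊢
    omega
  have hS' : ω.mirrorFar.2.firstSideG = .S := by rw [mirrorFar_firstSideG, hN]; rfl
  exact absurd (WE_eq_excursionWinding_of_under_rootS_killSE_floor hh' hRS' hK' hfloor' ω.mirrorFar hr' h' hS' _)
    (ω.mirrorFar_wound hr h hW)

/-- ★★★★★ **TWIN: `holeN = (w.1 − 1, w.2 + 1)` AND `(w.1 − 2, w.2 + 2)` ABSENT, CEILING THREE ROWS UP ⇒ NO WOUND OVER-WALK.**
[cite: GlazmanManolescu2019, §1 (Fig. 1, Fig. 2), §4.2 (lattice symmetries), Lemma 2.1]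
[cite: Glazman2015WeightedSAW, Lemma 3.1 (proof, pp. 6–7)] [cite: CourantRobbins1958, Ch. V Appendix §2 (the even–odd rule)] -/
theorem WE_eq_excursionWinding_of_over_holeN_farNWN_ceiling (hh : holeFaceW w ∉ D)
    (hHN : ((w.1 - 1, w.2 + 1) : Face) ∉ D) (hFN : ((w.1 - 2, w.2 + 2) : Face) ∉ D)
    (hceil : ∀ f : Face, f ∈ D → f.2 ≤ w.2 + 3)
    (ω : ΩG D (w.side .W) (farW w)) (hr : RootedFace D (w.side .W) (farW w)) (h : ω.IsB2a)
    (hN : ω.2.firstSideG = .N) (θ : ℝ) :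
    ω.WE (fun _ => θ) = excursionWinding θ ω.2.firstSideG (ω.z1 hr h) ω.1 := by
  by_contra hW
  have hr' := rootedFace_rowMirrorDom w hr
  have h' := ω.mirrorFar_isB2a hr h
  have hh' : holeFaceW w ∉ rowMirrorDom w D := by rwa [mem_rowMirrorDom, mirrorRowFace_holeFaceW]
  have hHS' : ((w.1 - 1, w.2 - 1) : Face) ∉ rowMirrorDom w D := by
    rw [mem_rowMirrorDom, mirrorRowFace_mkCL, show 2 * w.2 - (w.2 - 1) = w.2 + 1 by ring]; exact hHN
  have hFS' : ((w.1 - 2, w.2 - 2) : Face) ∉ rowMirrorDom w D := by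
    rw [mem_rowMirrorDom, mirrorRowFace_mkCL, show 2 * w.2 - (w.2 - 2) = w.2 + 2 by ring]; exact hFN
  have hfloor' : ∀ f : Face, f ∈ rowMirrorDom w D → w.2 - 3 ≤ f.2 := by
    intro f hf
    rw [mem_rowMirrorDom] at hf
    have := hceil _ hf
    obtain ⟨x, y⟩ := f
    rw [mirrorRowFace_mkCL] at this
    simp only at this ⊢
    omega
  have hS' : ω.mirrorFar.2.firstSideG = .S := by rw [mirrorFar_firstSideG, hN]; rfl
  exact absurd (WE_eq_excursionWinding_of_under_holeS_farSWS_floor hh' hHS' hFS' hfloor' ω.mirrorFar hr' h' hS' _)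
    (ω.mirrorFar_wound hr h hW)

/-- ★★★★★ **TWIN: `rootN` AND `killNE` ABSENT, EAST WALL TWO COLUMNS BEYOND THE ROOT PLAQUETTE ⇒ NO WOUND OVER-WALK.**
[cite: GlazmanManolescu2019, §1 (Fig. 1, Fig. 2), §4.2 (lattice symmetries), Lemma 2.1]
[cite: Glazman2015WeightedSAW, Lemma 3.1 (proof, pp. 6–7)] [cite: CourantRobbins1958, Ch. V Appendix §2 (the even–odd rule)] -/
theorem WE_eq_excursionWinding_of_over_rootN_killNE_eastWall (hh : holeFaceW w ∉ D) (hRN : rootN w ∉ D)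
    (hK : killNE w ∉ D) (heast : ∀ f : Face, f ∈ D → f.1 < w.1 + 3)
    (ω : ΩG D (w.side .W) (farW w)) (hr : RootedFace D (w.side .W) (farW w)) (h : ω.IsB2a)
    (hN : ω.2.firstSideG = .N) (θ : ℝ) :
    ω.WE (fun _ => θ) = excursionWinding θ ω.2.firstSideG (ω.z1 hr h) ω.1 := by
  by_contra hW
  have hr' := rootedFace_rowMirrorDom w hr
  have h' := ω.mirrorFar_isB2a hr h
  have hh' : holeFaceW w ∉ rowMirrorDom w D := by rwa [mem_rowMirrorDom, mirrorRowFace_holeFaceW]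
  have hRS' : rootS w ∉ rowMirrorDom w D := by rwa [mem_rowMirrorDom, mirrorRowFace_rootS]
  have hK' : killSE w ∉ rowMirrorDom w D := by rwa [mem_rowMirrorDom, mirrorRowFace_killSE]
  have heast' : ∀ f : Face, f ∈ rowMirrorDom w D → f.1 < w.1 + 3 := by
    intro f hf
    rw [mem_rowMirrorDom] at hf
    have := heast _ hf
    obtain ⟨x, y⟩ := f
    rw [mirrorRowFace_mkCL] at this
    exact this
  have hS' : ω.mirrorFar.2.firstSideG = .S := by rw [mirrorFar_firstSideG, hN]; rfl
  exact absurd (WE_eq_excursionWinding_of_under_rootS_killSE_eastWall hh' hRS' hK' heast' ω.mirrorFar hr' h' hS' _)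
    (ω.mirrorFar_wound hr h hW)

end ΩG

end Literature.Probability.RandomPlanarGeometry.SAW.YangBaxter

namespace Literature.Barriers.CriticalPhenomena.PlaquetteWalk

open Literature.Probability.RandomPlanarGeometry.SAW.YangBaxter
open Real Complex

/-! ## §3′ Boxes: the three decided cells of the ring + near census -/

section Boxes

variable {m n : ℕ} {S : List Face} {h : Face}

/-- ★★★★★ **ALL BOXES WITH THREE ROWS BELOW THE HOLE (`h.2 = 3`): `rootS = (h.1 + 1, 2)` AND `K_S1 = (h.1 + 2, 1)` REMOVED ⇒ NO
WOUND UNDER-WALK**, whatever else `S ∋ h` removes (far cell kept).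
[cite: GlazmanManolescu2019, Lemma 2.1 (statement, "in the form given in [Gl]"), §2.1]
[cite: Glazman2015WeightedSAW, Lemma 3.1 (proof, pp. 6–7)] [cite: CourantRobbins1958, Ch. V Appendix §2 (the even–odd rule)] -/
theorem lawL_box_rootS_killSE_h3_not_wound_under (hW : 1 ≤ h.1) (hE : h.1 ≤ m) (hS3 : h.2 = 3) (hN : 4 ≤ n)
    (hh : h ∈ S) (hfS : ((h.1 - 1, h.2) : Face) ∉ S) (hcS : ((h.1 + 1, 2) : Face) ∈ S) (hcK : ((h.1 + 2, 1) : Face) ∈ S)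
    (ω : ΩG (dom (boxMinus m n S)) (Face.side (h.1 + 1, h.2) .W) (farW (h.1 + 1, h.2))) (hb : ω.IsB2a)
    (hS' : ω.2.firstSideG = .S) (θ : ℝ) :
    ω.WE (fun _ => θ) = excursionWinding θ ω.2.firstSideG
      (ω.z1 (rootedFace_hroot_boxMinus_of_mem (farW_hroot_mem_boxMinus_of_not_mem hW hE (by omega) (by omega) hfS) hh)
        hb) ω.1 := by
  refine ΩG.WE_eq_excursionWinding_of_under_rootS_killSE_floor ?_ ?_ ?_ (fun f hf => ?_) ω _ hb hS' θ
  · rw [holeFaceW_hroot]; exact not_mem_dom_boxMinus_of_mem hh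
  · have e : rootS ((h.1 + 1, h.2) : Face) = (h.1 + 1, 2) := Prod.ext (by simp only [rootS]) (by simp only [rootS]; omega)
    rw [e]; exact not_mem_dom_boxMinus_of_mem hcS
  · have e : killSE ((h.1 + 1, h.2) : Face) = (h.1 + 2, 1) :=
      Prod.ext (by simp only [killSE]; ring) (by simp only [killSE]; omega)
    rw [e]; exact not_mem_dom_boxMinus_of_mem hcK
  · obtain ⟨hb', -⟩ := mem_dom_boxMinus.1 hf
    simp only at hb' ⊢
    omega

/-- ★★★★★ **ALL BOXES WITH THREE ROWS BELOW THE HOLE (`h.2 = 3`): `holeS = (h.1, 2)` AND THE CELL `(h.1 − 1, 1)` TWO BELOW THE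
FAR CELL REMOVED ⇒ NO WOUND UNDER-WALK**, whatever else `S ∋ h` removes (far cell kept).
[cite: GlazmanManolescu2019, Lemma 2.1 (statement, "in the form given in [Gl]"), §2.1]
[cite: Glazman2015WeightedSAW, Lemma 3.1 (proof, pp. 6–7)] [cite: CourantRobbins1958, Ch. V Appendix §2 (the even–odd rule)] -/
theorem lawL_box_holeS_farSWS_h3_not_wound_under (hW : 1 ≤ h.1) (hE : h.1 ≤ m) (hS3 : h.2 = 3) (hN : 4 ≤ n)
    (hh : h ∈ S) (hfS : ((h.1 - 1, h.2) : Face) ∉ S) (hcH : ((h.1, 2) : Face) ∈ S) (hcF : ((h.1 - 1, 1) : Face) ∈ S)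
    (ω : ΩG (dom (boxMinus m n S)) (Face.side (h.1 + 1, h.2) .W) (farW (h.1 + 1, h.2))) (hb : ω.IsB2a)
    (hS' : ω.2.firstSideG = .S) (θ : ℝ) :
    ω.WE (fun _ => θ) = excursionWinding θ ω.2.firstSideG
      (ω.z1 (rootedFace_hroot_boxMinus_of_mem (farW_hroot_mem_boxMinus_of_not_mem hW hE (by omega) (by omega) hfS) hh)
        hb) ω.1 := by
  refine ΩG.WE_eq_excursionWinding_of_under_holeS_farSWS_floor ?_ ?_ ?_ (fun f hf => ?_) ω _ hb hS' θ
  · rw [holeFaceW_hroot]; exact not_mem_dom_boxMinus_of_mem hh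
  · have e : ((h.1 + 1 - 1, h.2 - 1) : Face) = (h.1, 2) := Prod.ext (by simp only; ring) (by simp only; omega)
    rw [e]; exact not_mem_dom_boxMinus_of_mem hcH
  · have e : ((h.1 + 1 - 2, h.2 - 2) : Face) = (h.1 - 1, 1) := Prod.ext (by simp only; ring) (by simp only; omega)
    rw [e]; exact not_mem_dom_boxMinus_of_mem hcF
  · obtain ⟨hb', -⟩ := mem_dom_boxMinus.1 hf
    simp only at hb' ⊢
    omega

/-- ★★★★★ **ALL BOXES WITH `rootE` IN THE SECOND-TO-LAST COLUMN (`h.1 + 4 = m`): `rootS = (h.1 + 1, h.2 − 1)` AND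
`K_S1 = (h.1 + 2, h.2 − 2)` REMOVED ⇒ NO WOUND UNDER-WALK**, any height, whatever else `S ∋ h` removes (far cell kept).
(`K_S1` may also lie below the box: then list it in `S` all the same, or read the cell as absent.)
[cite: GlazmanManolescu2019, Lemma 2.1 (statement, "in the form given in [Gl]"), §2.1]
[cite: Glazman2015WeightedSAW, Lemma 3.1 (proof, pp. 6–7)] [cite: CourantRobbins1958, Ch. V Appendix §2 (the even–odd rule)] -/
theorem lawL_box_rootS_killSE_eastCol_not_wound_under (hW : 1 ≤ h.1) (hE4 : h.1 + 4 = m) (hS0 : 0 ≤ h.2) (hN : h.2 + 1 ≤ n)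
    (hh : h ∈ S) (hfS : ((h.1 - 1, h.2) : Face) ∉ S) (hcS : ((h.1 + 1, h.2 - 1) : Face) ∈ S)
    (hcK : ((h.1 + 2, h.2 - 2) : Face) ∈ S)
    (ω : ΩG (dom (boxMinus m n S)) (Face.side (h.1 + 1, h.2) .W) (farW (h.1 + 1, h.2))) (hb : ω.IsB2a)
    (hS' : ω.2.firstSideG = .S) (θ : ℝ) :
    ω.WE (fun _ => θ) = excursionWinding θ ω.2.firstSideG
      (ω.z1 (rootedFace_hroot_boxMinus_of_mem (farW_hroot_mem_boxMinus_of_not_mem hW (by omega) hS0 hN hfS) hh) hb)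
      ω.1 := by
  refine ΩG.WE_eq_excursionWinding_of_under_rootS_killSE_eastWall ?_ ?_ ?_ (fun f hf => ?_) ω _ hb hS' θ
  · rw [holeFaceW_hroot]; exact not_mem_dom_boxMinus_of_mem hh
  · have e : rootS ((h.1 + 1, h.2) : Face) = (h.1 + 1, h.2 - 1) := Prod.ext (by simp only [rootS]) rfl
    rw [e]; exact not_mem_dom_boxMinus_of_mem hcS
  · have e : killSE ((h.1 + 1, h.2) : Face) = (h.1 + 2, h.2 - 2) := Prod.ext (by simp only [killSE]; ring) rfl
    rw [e]; exact not_mem_dom_boxMinus_of_mem hcK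
  · obtain ⟨hb', -⟩ := mem_dom_boxMinus.1 hf
    simp only at hb' ⊢
    omega

/-- ★★★★★ **TWIN, THREE ROWS ABOVE THE HOLE (`h.2 + 4 = n`): `rootN = (h.1 + 1, h.2 + 1)` AND `K_N2 = (h.1 + 2, h.2 + 2)` REMOVED ⇒
NO WOUND OVER-WALK**, whatever else `S ∋ h` removes (far cell kept).
[cite: GlazmanManolescu2019, Lemma 2.1 (statement, "in the form given in [Gl]"), §2.1, §4.2]
[cite: Glazman2015WeightedSAW, Lemma 3.1 (proof, pp. 6–7)] [cite: CourantRobbins1958, Ch. V Appendix §2 (the even–odd rule)] -/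
theorem lawL_box_rootN_killNE_n4_not_wound_over (hW : 1 ≤ h.1) (hE : h.1 ≤ m) (hS0 : 0 ≤ h.2) (hN4 : h.2 + 4 = n)
    (hh : h ∈ S) (hfS : ((h.1 - 1, h.2) : Face) ∉ S) (hcN : ((h.1 + 1, h.2 + 1) : Face) ∈ S)
    (hcK : ((h.1 + 2, h.2 + 2) : Face) ∈ S)
    (ω : ΩG (dom (boxMinus m n S)) (Face.side (h.1 + 1, h.2) .W) (farW (h.1 + 1, h.2))) (hb : ω.IsB2a)
    (hN' : ω.2.firstSideG = .N) (θ : ℝ) :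
    ω.WE (fun _ => θ) = excursionWinding θ ω.2.firstSideG
      (ω.z1 (rootedFace_hroot_boxMinus_of_mem (farW_hroot_mem_boxMinus_of_not_mem hW hE hS0 (by omega) hfS) hh) hb)
      ω.1 := by
  refine ΩG.WE_eq_excursionWinding_of_over_rootN_killNE_ceiling ?_ ?_ ?_ (fun f hf => ?_) ω _ hb hN' θ
  · rw [holeFaceW_hroot]; exact not_mem_dom_boxMinus_of_mem hh
  · have e : rootN ((h.1 + 1, h.2) : Face) = (h.1 + 1, h.2 + 1) := Prod.ext (by simp only [rootN]) rfl
    rw [e]; exact not_mem_dom_boxMinus_of_mem hcN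
  · have e : killNE ((h.1 + 1, h.2) : Face) = (h.1 + 2, h.2 + 2) := Prod.ext (by simp only [killNE]; ring) rfl
    rw [e]; exact not_mem_dom_boxMinus_of_mem hcK
  · obtain ⟨hb', -⟩ := mem_dom_boxMinus.1 hf
    simp only at hb' ⊢
    omega

/-- ★★★★★ **TWIN, THREE ROWS ABOVE THE HOLE (`h.2 + 4 = n`): `holeN = (h.1, h.2 + 1)` AND THE CELL `(h.1 − 1, h.2 + 2)` TWO ABOVE
THE FAR CELL REMOVED ⇒ NO WOUND OVER-WALK**, whatever else `S ∋ h` removes (far cell kept).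
[cite: GlazmanManolescu2019, Lemma 2.1 (statement, "in the form given in [Gl]"), §2.1, §4.2]
[cite: Glazman2015WeightedSAW, Lemma 3.1 (proof, pp. 6–7)] [cite: CourantRobbins1958, Ch. V Appendix §2 (the even–odd rule)] -/
theorem lawL_box_holeN_farNWN_n4_not_wound_over (hW : 1 ≤ h.1) (hE : h.1 ≤ m) (hS0 : 0 ≤ h.2) (hN4 : h.2 + 4 = n)
    (hh : h ∈ S) (hfS : ((h.1 - 1, h.2) : Face) ∉ S) (hcH : ((h.1, h.2 + 1) : Face) ∈ S)
    (hcF : ((h.1 - 1, h.2 + 2) : Face) ∈ S)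
    (ω : ΩG (dom (boxMinus m n S)) (Face.side (h.1 + 1, h.2) .W) (farW (h.1 + 1, h.2))) (hb : ω.IsB2a)
    (hN' : ω.2.firstSideG = .N) (θ : ℝ) :
    ω.WE (fun _ => θ) = excursionWinding θ ω.2.firstSideG
      (ω.z1 (rootedFace_hroot_boxMinus_of_mem (farW_hroot_mem_boxMinus_of_not_mem hW hE hS0 (by omega) hfS) hh) hb)
      ω.1 := by
  refine ΩG.WE_eq_excursionWinding_of_over_holeN_farNWN_ceiling ?_ ?_ ?_ (fun f hf => ?_) ω _ hb hN' θ
  · rw [holeFaceW_hroot]; exact not_mem_dom_boxMinus_of_mem hh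
  · have e : ((h.1 + 1 - 1, h.2 + 1) : Face) = (h.1, h.2 + 1) := Prod.ext (by simp only; ring) rfl
    rw [e]; exact not_mem_dom_boxMinus_of_mem hcH
  · have e : ((h.1 + 1 - 2, h.2 + 2) : Face) = (h.1 - 1, h.2 + 2) := Prod.ext (by simp only; ring) rfl
    rw [e]; exact not_mem_dom_boxMinus_of_mem hcF
  · obtain ⟨hb', -⟩ := mem_dom_boxMinus.1 hf
    simp only at hb' ⊢
    omega

/-- ★★★★★ **TWIN, `rootE` IN THE SECOND-TO-LAST COLUMN (`h.1 + 4 = m`): `rootN = (h.1 + 1, h.2 + 1)` AND `K_N2 = (h.1 + 2, h.2 + 2)`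
REMOVED ⇒ NO WOUND OVER-WALK**, any height, whatever else `S ∋ h` removes (far cell kept).
[cite: GlazmanManolescu2019, Lemma 2.1 (statement, "in the form given in [Gl]"), §2.1, §4.2]
[cite: Glazman2015WeightedSAW, Lemma 3.1 (proof, pp. 6–7)] [cite: CourantRobbins1958, Ch. V Appendix §2 (the even–odd rule)] -/
theorem lawL_box_rootN_killNE_eastCol_not_wound_over (hW : 1 ≤ h.1) (hE4 : h.1 + 4 = m) (hS0 : 0 ≤ h.2) (hN : h.2 + 1 ≤ n)
    (hh : h ∈ S) (hfS : ((h.1 - 1, h.2) : Face) ∉ S) (hcN : ((h.1 + 1, h.2 + 1) : Face) ∈ S)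
    (hcK : ((h.1 + 2, h.2 + 2) : Face) ∈ S)
    (ω : ΩG (dom (boxMinus m n S)) (Face.side (h.1 + 1, h.2) .W) (farW (h.1 + 1, h.2))) (hb : ω.IsB2a)
    (hN' : ω.2.firstSideG = .N) (θ : ℝ) :
    ω.WE (fun _ => θ) = excursionWinding θ ω.2.firstSideG
      (ω.z1 (rootedFace_hroot_boxMinus_of_mem (farW_hroot_mem_boxMinus_of_not_mem hW (by omega) hS0 hN hfS) hh) hb)
      ω.1 := by
  refine ΩG.WE_eq_excursionWinding_of_over_rootN_killNE_eastWall ?_ ?_ ?_ (fun f hf => ?_) ω _ hb hN' θ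
  · rw [holeFaceW_hroot]; exact not_mem_dom_boxMinus_of_mem hh
  · have e : rootN ((h.1 + 1, h.2) : Face) = (h.1 + 1, h.2 + 1) := Prod.ext (by simp only [rootN]) rfl
    rw [e]; exact not_mem_dom_boxMinus_of_mem hcN
  · have e : killNE ((h.1 + 1, h.2) : Face) = (h.1 + 2, h.2 + 2) := Prod.ext (by simp only [killNE]; ring) rfl
    rw [e]; exact not_mem_dom_boxMinus_of_mem hcK
  · obtain ⟨hb', -⟩ := mem_dom_boxMinus.1 hf
    simp only at hb' ⊢
    omega

end Boxes

end Literature.Barriers.CriticalPhenomena.PlaquetteWalk
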